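import Mathlib
import Summits.ValiantsHypothesis.ValiantsHypothesis.Theorems.RigidityForcesSymmetryRankRigidMinimalReprLaplaceDefs
import Summits.ValiantsHypothesis.ValiantsHypothesis.Theorems.RigidityForcesSymmetryRankRigidMinimalReprLaplaceFiveFourSlicesAll

/-!
# A cheap split-rank-one decomposition of `P₅` has at most three slices
# (crux `RankRigidMinimalRepr`, stmt-ValiantsHypothesis-18034; frontier rung `LaplaceOptimalFive`, stmt-24813)

`laplace_five_at_most_three_slices`: in the data format of `LaplaceOptimal 5` — if split-rank-one terms
`u_t(v|_{S_t}) · w_t(v|_{S_tᶜ})`, `t ∈ T`, sum to the pattern `[v injective]` on `Fin 5 → Fin 5` with total Laplace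
weight `Σ_t |S_t|!(5-|S_t|)! < 120`, then at most three of the terms are SLICES (`|S_t| ∈ {1, 4}`).  This is the `d = 5`
analogue of p8 g9's Theorem E at `d = 4` (`laplace_four_at_most_one_slice`) and kills the 16 maximal cheap profiles with
four slices (of the 1 618).  Proof: with four slices the weight leaves room for at most one pair term (`|S_t| ∈ {2,3}`);
bring every slice to the form `α(v_s) · W(v)` (`W` blind to slot `s`; `slice_normal_form`) and the pair term to
`u(v_p,v_q) · w(v)` (`pair_normal_form`), and apply `LaplaceFiveSlices.four_slices_one_pair_all`.

HONEST FRAMING: an exact partial result toward the frontier rung `LaplaceOptimalFive` (stmt-24813; it asks for weight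
`≥ 120`, i.e. no cheap decomposition at all); the item stays OPEN; nothing here bears on `VP ≠ VNP`.
-/

set_option autoImplicit false

-- the mandated summit-side namespace repeats a component by design (single-problem summit)
set_option linter.dupNamespace false

namespace Summit.ValiantsHypothesis.ValiantsHypothesis.Theorems.RigidityForcesSymmetryRankRigidMinimalRepr

namespace LaplaceFiveSlices

open Finset

/-! ### §1 Normal forms of slice and pair terms -/

/-- A slice term (`|S| = 1` or `|S| = 4`) is `α(v_s) · W(v)` with `W` blind to the slot `s`. -/
theorem slice_normal_form (S : Finset (Fin 5)) (u w : (Fin 5 → Fin 5) → ℂ)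
    (hu : ∀ v v' : Fin 5 → Fin 5, (∀ i ∈ S, v i = v' i) → u v = u v')
    (hw : ∀ v v' : Fin 5 → Fin 5, (∀ i, i ∉ S → v i = v' i) → w v = w v')
    (h : S.card = 1 ∨ S.card = 4) :
    ∃ (s : Fin 5) (α : Fin 5 → ℂ) (W : (Fin 5 → Fin 5) → ℂ),
      (∀ v v' : Fin 5 → Fin 5, (∀ j, j ≠ s → v j = v' j) → W v = W v') ∧ ∀ v, u v * w v = α (v s) * W v := by
  classical
  rcases h with h | h
  · obtain ⟨s, hs⟩ := card_eq_one.mp h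
    refine ⟨s, fun c => u (fun _ => c), w, fun v v' hvv' => hw v v' (fun i hi => hvv' i ?_), fun v => ?_⟩
    · rw [hs, mem_singleton] at hi; exact hi
    · rw [hu v (fun _ => v s) (fun i hi => by rw [hs, mem_singleton] at hi; rw [hi])]
  · have hc : Sᶜ.card = 1 := by rw [card_compl, h]; rfl
    obtain ⟨s, hs⟩ := card_eq_one.mp hc
    have hsS : s ∉ S := by rw [← mem_compl, hs]; exact mem_singleton_self s
    refine ⟨s, fun c => w (fun _ => c), u, fun v v' hvv' => hu v v' (fun i hi => hvv' i ?_), fun v => ?_⟩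
    · rintro rfl; exact hsS hi
    · rw [hw v (fun _ => v s) (fun i hi => by
        have : i ∈ Sᶜ := mem_compl.mpr hi
        rw [hs, mem_singleton] at this; rw [this]), mul_comm]

/-- A pair term (`|S| = 2` or `|S| = 3`) is `u'(v_p, v_q) · w'(v)` with `w'` blind to `p, q`. -/
theorem pair_normal_form (S : Finset (Fin 5)) (u w : (Fin 5 → Fin 5) → ℂ)
    (hu : ∀ v v' : Fin 5 → Fin 5, (∀ i ∈ S, v i = v' i) → u v = u v')
    (hw : ∀ v v' : Fin 5 → Fin 5, (∀ i, i ∉ S → v i = v' i) → w v = w v')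
    (h : S.card = 2 ∨ S.card = 3) :
    ∃ (p q : Fin 5) (u' w' : (Fin 5 → Fin 5) → ℂ), p ≠ q ∧
      (∀ v v' : Fin 5 → Fin 5, v p = v' p → v q = v' q → u' v = u' v') ∧
      (∀ v v' : Fin 5 → Fin 5, (∀ j, j ≠ p → j ≠ q → v j = v' j) → w' v = w' v') ∧
      ∀ v, u v * w v = u' v * w' v := by
  classical
  rcases h with h | h
  · obtain ⟨p, q, hpq, hS⟩ := card_eq_two.mp h
    refine ⟨p, q, u, w, hpq, fun v v' hp hq => hu v v' (fun i hi => ?_),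
      fun v v' hvv' => hw v v' (fun i hi => hvv' i ?_ ?_), fun v => rfl⟩
    · rw [hS, mem_insert, mem_singleton] at hi
      rcases hi with rfl | rfl
      · exact hp
      · exact hq
    · rintro rfl; exact hi (by rw [hS]; simp)
    · rintro rfl; exact hi (by rw [hS]; simp)
  · have hc : Sᶜ.card = 2 := by rw [card_compl, h]; rfl
    obtain ⟨p, q, hpq, hS⟩ := card_eq_two.mp hc
    have hp : p ∉ S := by rw [← mem_compl, hS]; simp
    have hq : q ∉ S := by rw [← mem_compl, hS]; simp
    refine ⟨p, q, w, u, hpq, fun v v' hvp hvq => hw v v' (fun i hi => ?_),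
      fun v v' hvv' => hu v v' (fun i hi => hvv' i ?_ ?_), fun v => mul_comm _ _⟩
    · have : i ∈ Sᶜ := mem_compl.mpr hi
      rw [hS, mem_insert, mem_singleton] at this
      rcases this with rfl | rfl
      · exact hvp
      · exact hvq
    · rintro rfl; exact hp hi
    · rintro rfl; exact hq hi

/-! ### §2 At most three slices -/

/-- **A cheap split-rank-one decomposition of `P₅` has at most three slices.**  In the data format of `LaplaceOptimal 5`:
if the terms sum to the pattern with total Laplace weight `< 120`, then at most three terms have `|S_t| ∈ {1, 4}`. -/
theorem laplace_five_at_most_three_slices {N : ℕ} (T : Finset (Fin N)) (S : Fin N → Finset (Fin 5))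
    (u w : Fin N → (Fin 5 → Fin 5) → ℂ)
    (hu : ∀ t, ∀ v v' : Fin 5 → Fin 5, (∀ i ∈ S t, v i = v' i) → u t v = u t v')
    (hw : ∀ t, ∀ v v' : Fin 5 → Fin 5, (∀ i, i ∉ S t → v i = v' i) → w t v = w t v')
    (hsum : ∀ v : Fin 5 → Fin 5, (∑ t ∈ T, u t v * w t v) = if Function.Injective v then 1 else 0)
    (hlt : ∑ t ∈ T, (S t).card.factorial * (5 - (S t).card).factorial < 120) :
    (T.filter (fun t => (S t).card = 1 ∨ (S t).card = 4)).card ≤ 3 := by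
  classical
  by_contra hge
  push Not at hge
  -- every term is a slice or a pair term
  have hwt : ∀ t ∈ T, (S t).card.factorial * (5 - (S t).card).factorial < 120 := fun t ht =>
    lt_of_le_of_lt (single_le_sum (f := fun t => (S t).card.factorial * (5 - (S t).card).factorial)
      (fun _ _ => Nat.zero_le _) ht) hlt
  have hcard5 : ∀ t, (S t).card ≤ 5 := fun t => (card_le_univ _).trans (by simp)
  have htype : ∀ t ∈ T, ((S t).card = 1 ∨ (S t).card = 4) ∨ ((S t).card = 2 ∨ (S t).card = 3) := by
    intro t ht
    have h1 := hwt t ht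
    have h2 := hcard5 t
    interval_cases hc : (S t).card <;> simp_all (config := {decide := true})
  set Sl := T.filter (fun t => (S t).card = 1 ∨ (S t).card = 4) with hSl
  set Pr := T.filter (fun t => (S t).card = 2 ∨ (S t).card = 3) with hPr
  have hdisj : Disjoint Sl Pr := by
    rw [hSl, hPr, disjoint_filter]; intro t _ h1 h2; omega
  have hunion : T = Sl ∪ Pr := by
    ext t
    simp only [hSl, hPr, mem_union, mem_filter]
    constructor
    · intro ht; rcases htype t ht with h | h
      · exact Or.inl ⟨ht, h⟩
      · exact Or.inr ⟨ht, h⟩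
    · rintro (⟨ht, -⟩ | ⟨ht, -⟩) <;> exact ht
  -- the weight: 24 |Sl| + 12 |Pr| < 120
  have hweight : 24 * Sl.card + 12 * Pr.card < 120 := by
    have e1 : ∑ t ∈ Sl, (S t).card.factorial * (5 - (S t).card).factorial = 24 * Sl.card := by
      rw [mul_comm, ← smul_eq_mul, ← sum_const]
      refine sum_congr rfl fun t ht => ?_
      rw [hSl, mem_filter] at ht
      rcases ht.2 with h | h <;> rw [h] <;> decide
    have e2 : ∑ t ∈ Pr, (S t).card.factorial * (5 - (S t).card).factorial = 12 * Pr.card := by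
      rw [mul_comm, ← smul_eq_mul, ← sum_const]
      refine sum_congr rfl fun t ht => ?_
      rw [hPr, mem_filter] at ht
      rcases ht.2 with h | h <;> rw [h] <;> decide
    rw [hunion, sum_union hdisj, e1, e2] at hlt
    exact hlt
  have hSl4 : Sl.card = 4 := by omega
  have hPr1 : Pr.card ≤ 1 := by omega
  -- normal forms of the four slices
  have key : ∀ x : Sl, ∃ (s : Fin 5) (α : Fin 5 → ℂ) (W : (Fin 5 → Fin 5) → ℂ),
      (∀ v v' : Fin 5 → Fin 5, (∀ j, j ≠ s → v j = v' j) → W v = W v') ∧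
      ∀ v, u x v * w x v = α (v s) * W v := fun x =>
    slice_normal_form (S x) (u x) (w x) (hu x) (hw x) (by
      have hx : (x : Fin N) ∈ T.filter (fun t => (S t).card = 1 ∨ (S t).card = 4) := x.2
      exact (mem_filter.mp hx).2)
  choose slot α W hWb hterm using key
  have hcardSl : Fintype.card Sl = 4 := by rw [Fintype.card_coe, hSl4]
  let e : Sl ≃ Fin 4 := Fintype.equivFinOfCardEq hcardSl
  -- the pair term (or none)
  obtain ⟨p, q, u', w', hpq, hu', hw', hpair⟩ : ∃ (p q : Fin 5) (u' w' : (Fin 5 → Fin 5) → ℂ), p ≠ q ∧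
      (∀ v v' : Fin 5 → Fin 5, v p = v' p → v q = v' q → u' v = u' v') ∧
      (∀ v v' : Fin 5 → Fin 5, (∀ j, j ≠ p → j ≠ q → v j = v' j) → w' v = w' v') ∧
      ∀ v, ∑ t ∈ Pr, u t v * w t v = u' v * w' v := by
    rcases Nat.eq_zero_or_pos Pr.card with h0 | hpos
    · refine ⟨0, 1, 0, 0, by decide, fun _ _ _ _ => rfl, fun _ _ _ => rfl, fun v => ?_⟩
      rw [Finset.card_eq_zero.mp h0, sum_empty]; simp
    · have h1 : Pr.card = 1 := by omega
      obtain ⟨t₀, ht₀⟩ := card_eq_one.mp h1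
      have ht₀T : t₀ ∈ Pr := by rw [ht₀]; exact mem_singleton_self _
      obtain ⟨p, q, u', w', hpq, hu', hw', hterm₀⟩ := pair_normal_form (S t₀) (u t₀) (w t₀) (hu t₀) (hw t₀)
        (by rw [hPr, mem_filter] at ht₀T; exact ht₀T.2)
      refine ⟨p, q, u', w', hpq, hu', hw', fun v => ?_⟩
      rw [ht₀, sum_singleton, hterm₀]
  -- the explicit identity
  have H : ∀ v : Fin 5 → Fin 5, (if Function.Injective v then (1 : ℂ) else 0) =
      (∑ k : Fin 4, (fun k => α (e.symm k)) k (v ((fun k => slot (e.symm k)) k)) * (fun k => W (e.symm k)) k v) +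
        u' v * w' v := by
    intro v
    rw [← hsum v, hunion, sum_union hdisj, hpair v]
    congr 1
    rw [← sum_coe_sort Sl]
    simp only [hterm]
    exact Fintype.sum_equiv e _ _ (fun x => by simp)
  exact four_slices_one_pair_all (fun k => slot (e.symm k)) (fun k => α (e.symm k)) (fun k => W (e.symm k))
    (fun k => hWb (e.symm k)) p q hpq u' w' hu' hw' H

end LaplaceFiveSlices

end Summit.ValiantsHypothesis.ValiantsHypothesis.Theorems.RigidityForcesSymmetryRankRigidMinimalRepr
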